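import Literature.Analysis.FluidPDE.ZerothLaw
import HarnessLib
import HarnessLib.Audit

/-!
# Barrier (AnomalousDissipation): long-time dissipation estimates that are robust under
`C(ℝ; L²)`-perturbations of the force cannot decide the zeroth law (Cheskidov 2023, Thm. 1.3)
(D-0021 barrier catalogue for `Summits/AnomalousDissipation`; summit statement
`AnomalousDissipation := Literature.Turb.ZerothLaw`; dual `Literature.Analysis.FluidPDE.ZerothLawNeg`)

A. Cheskidov, *Dissipation anomaly and anomalous dissipation in incompressible fluid flows*,
arXiv:2311.04182 (2023), §1.2. For long-time averages `ε = ⟨ν‖∇u^ν‖²⟩`, `U² = ⟨‖u^ν‖²⟩`,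
`Re = Uℓ/ν` the Doering–Foias upper bound `εℓ/U³ ≤ c₁ + c₂Re⁻¹` (Doering–Foias, JFM 467 (2002);
accepted `Literature.Analysis.FluidPDE.doering_foias_bound`) is proved there uniformly over Leray–Hopf solutions
driven by forces `f(x,t) = Fφ^j(ℓ⁻¹x,t)` whose shapes converge, `φ^j → φ` in `C(ℝ; L²(T³))`
(Thm. 1.2: "following the argument of Doering and Foias"), and it is shown to be *attained* in
that class: for every `ℓ, U, c > 0` there are smooth time-periodic solutions `u^{ν_j}`,
`ν_j → 0`, with forces `f^{ν_j} → f` in `C(ℝ; L²)` and `εℓ/U³ → c` (Thm. 1.3; accepted named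
fact `Literature.Analysis.FluidPDE.cheskidov_time_periodic_anomaly`) — "proving that the Doering–Foias (2002) upper
bound is sharp" (abstract). With a *fixed* force, on the contrary, "there is no known example of
a sequence of the NSE solutions with `Re → ∞`, where [the Doering–Foias] bound … is attained" (§1.2), which is
the summit `Literature.Turb.ZerothLaw` (steady force) / `Literature.Analysis.FluidPDE.ZerothLawTimePeriodic`.

Read as a no-go: an argument towards the dual statement `Literature.Analysis.FluidPDE.ZerothLawNeg` ("`ν_j⟨‖∇u_j‖²⟩
→ 0` for every family with bounded mean energy") whose conclusion survives replacing the fixed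
force by smooth, `ν`-dependent, time-periodic forces converging to it uniformly in `L²` — as the
energy-method bounds of Doering–Foias type do (Thm. 1.2) — would prove `ForceRobustNoAnomalyAt τ f`
below for every period `τ` and every limit force `f`, which Thm. 1.3 refutes.

## What is vendored

* `ForceRobustNoAnomalyAt τ f` — the technique class made explicit, as a predicate of the period
  `τ` and the limit force `f`: the force-robust form of `Literature.Analysis.FluidPDE.ZerothLawNeg`
  for smooth time-periodic families around `f` (same clauses, in the same accepted notions, as
  `Literature.Analysis.FluidPDE.cheskidov_time_periodic_anomaly`: `Torus.IsClassicalNSSolutionOn univ`,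
  `Torus.ContinuousInLpOn univ 2`, `Literature.Analysis.FluidPDE.meanEnergy`,
  `Literature.Analysis.FluidPDE.meanDissipation`). Its closure over all `(τ, f)` is the former closed
  def `ForceRobustNoAnomaly` (deprecated, see "Verdict clean-up" below).
* `Cheskidov2023_thm13_exists_not_forceRobustNoAnomalyAt`, `Cheskidov2023_thm13_not_forceRobustNoAnomaly`
  (alias `not_forceRobustNoAnomaly`) — **proved**: Thm. 1.3 (as the accepted named fact,
  hypothesis `h`) exhibits `(τ, f)` with `¬ ForceRobustNoAnomalyAt τ f`, hence refutes
  `∀ τ f, ForceRobustNoAnomalyAt τ f`. The barrier block sits on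
  `Cheskidov2023_thm13_not_forceRobustNoAnomaly`.
* `ForceRobustNoAnomalyNarrow` (audit 2026-08-15) — the un-refuted residual of the technique
  class (limit force smooth, forces converging in `C(ℝ; H¹)`), with the **proved** comparison
  `ForceRobustNoAnomaly.narrow` and the fixed-force specialisation
  `ForceRobustNoAnomalyNarrow.fixedForce`; a registered open statement (`[status: open]`), neither
  a barrier nor literature debt.
* Nothing of the source is restated: Thm. 1.3 itself is the accepted
  `Literature.Analysis.FluidPDE.cheskidov_time_periodic_anomaly` (Literature/Analysis/FluidPDE/ZerothLaw.lean).

## Verdict clean-up 2026-08-15 (defact-verdict unit; verdicts of the two prove-seats re-verified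
against arXiv:2311.04182 §1.2, Thms. 1.2–1.3, p. 4–5, and against the tree)

* `ForceRobustNoAnomaly` (closed `def … : Prop`, the technique class written as ONE proposition
  `∀ τ f ν f_j u_j p_j, …`) — REFUTED, by design: it is the class of conclusions the barrier stops,
  not a published result, and no `ForceRobustNoAnomaly_holds` can exist; its negation is the
  in-tree theorem `Cheskidov2023_thm13_not_forceRobustNoAnomaly` (from the accepted named fact
  `Literature.Analysis.FluidPDE.cheskidov_time_periodic_anomaly`, Thm. 1.3; in the tree that fact is
  reduced to `Literature.Analysis.FluidPDE.acm_compatible_blocks` by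
  `cheskidov_time_periodic_anomaly_of_compatible_blocks`). Treatment (RETIRE-REFUTED): the
  technique class is now the parametrised predicate `ForceRobustNoAnomalyAt τ f` (the same clauses,
  curried in `(τ, f)`) and every statement of this file is written with it; the closed def is KEPT
  for the records that name it (the `Barriers:` lines of the AnomalousDissipation theses) but
  `@[deprecated]`, with body `∀ τ f, ForceRobustNoAnomalyAt τ f` — definitionally the original
  statement — and a pointer to the refuting theorems `not_forceRobustNoAnomaly` /
  `Cheskidov2023_thm13_not_forceRobustNoAnomaly`. The barrier itself is unchanged.
* `ForceRobustNoAnomalyNarrow` — OPEN PROBLEM, correctly so: Thm. 1.3 refutes only the wide class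
  (forces converging in `C(ℝ; L²)`, rough time-dependent limit force, p. 5), and for a fixed or
  smooth force the source itself calls the existence of a saturating sequence "an important open
  problem" (p. 5, after Thm. 1.3); no statement of the source or of the re-checked literature
  proves or refutes the residual. Treatment (MARK-OPEN): it stays the registered OPEN statement it
  was filed as (`OPEN CONJECTURE — … [status: open]`, CONVENTIONS §4), deliberately without
  `ForceRobustNoAnomalyNarrow_holds`; name kept, no `…Conjecture` rename, because it has users
  (`ForceRobustNoAnomaly.narrow`, `ForceRobustNoAnomalyNarrow.fixedForce`, and the theses
  `BaireTransfer`, `FiniteIntersection`, `ResponseTelescope` name it).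

## Audit 2026-08-15 (D-0021 barrier audit): technique class NARROWED

What Thm. 1.3 refutes is exactly `∀ τ f, ForceRobustNoAnomalyAt τ f` (the retired closed def
`ForceRobustNoAnomaly`): no-anomaly conclusions that survive
(i) `C(ℝ; L²)`-small `ν`-dependent perturbations of the force, (ii) a limit force that is
time-dependent and only `C(ℝ; C^α(T³))`, `α < 1`, in space — the planar drift force
`g = ∂ₜṽ + (ṽ·∇)ṽ` of the glued Alberti–Crippa–Mazzucato blocks (`‖∂ₜᵏ v_n‖_{C^α} ≲ λ_n^{α-1}`
for all `α ≥ 0`, op. cit. Thm. 3.1; `g^m → g` in `C([0,1]; C^α)`, `α ∈ (0,1)`, op. cit. §3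
p. 10), the third component `h^m = η'(t) θ̃^m → h` converging in `L^∞(ℝ; L²)` only (op. cit. §6
p. 18) — and (iii) the restriction to smooth time-periodic solutions with one common period. The
source asserts the convergence `f^{ν_j} → f` in `C(ℝ; L²)` only, and nothing better can be read
off: block `n` is compressed into a time interval of length `∼ n⁻³`, so by the printed block
bounds its contribution to the drift force has `C¹`- and `H¹`-size of order `n⁶ · λ_n⁰` — no
decay in `n` (this file's reading of the printed bounds) — in line with the Bruè–De Lellis
threshold: forces bounded in `C([0,1]; W^{1,p})`, `p < ∞`, give only enhanced dissipation in that
scheme (BDL 2023, §1 Thm. 1.2), forces bounded in `C([0,1]; C^α)`, `α < 1`, give the anomaly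
(Thm. 1.1). Consequently **vorticity-level** a-priori estimates — those pairing the equations
with derivatives of the force, with constants involving `‖∇f‖`, `‖Δf‖`, as in every
two-dimensional no-anomaly proof (Alexakis–Doering 2006, §2: `χ = ⟨ω curl f⟩ ≤ k_f² U F`,
`k_f² = ‖Δf‖/‖f‖`, whence `ε ≤ (νU²χ)^{1/2} = O(Re^{-1/2})`;
`Literature.Barriers.AnomalousDissipation.AlexakisDoering2006_energyDissipationBound`) — and
arguments that use the steadiness or the smoothness of the *given* force are **not** in the
refuted class: their force-robust form is `ForceRobustNoAnomalyNarrow` below (limit force smooth,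
forces converging in `C(ℝ; H¹)`), which Thm. 1.3 does not refute; it is registered as an OPEN
statement (`OPEN CONJECTURE — …`, `[status: open]`, CONVENTIONS §4), not as literature debt — no
`_holds` theorem is to be expected — with the proved comparisons `ForceRobustNoAnomaly.narrow`
and `ForceRobustNoAnomalyNarrow.fixedForce`. The block's tags
`energy-method a-priori-estimates upper-bound-methods` are to be read with the qualifiers
`velocity-level`, `l2-dual-in-the-force`; see scope caveats (d)–(f). Literature re-checked
(2026-08): no anomalous-dissipation family with a `ν`-independent force is published, on finite
windows (BDL 2023, §2 Question 1, open) or in the long-time mean; the time-independence question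
(BDL §2 Question 2) is answered with `ν`-dependent autonomous forces on `[0,1]`
(Johansson–Sorella 2024, Thm. 1.5), which is no evasion of this barrier.

## References

* A. Cheskidov, arXiv:2311.04182 (2023), §1.2: the definitions of `ε, U, Re` by generalized Banach limits and the Doering–Foias bound, Thm. 1.2, Thm. 1.3, the paragraph
  following Thm. 1.3, Remarks 1.4–1.6.
* C. R. Doering, C. Foias, J. Fluid Mech. 467 (2002) 289–306 (the bound (38)).
* E. Bruè, C. De Lellis, Comm. Math. Phys. 400 (2023), §2, Questions 2.1–2.2 (fixed force: open).
* C. J. P. Johansson, M. Sorella, *Anomalous dissipation via spontaneous stochasticity with a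
  two-dimensional autonomous velocity field*, arXiv:2409.03599 (2024; Duke Math. J., to appear), §1 Thm. 1.5.
* A. Cheskidov, Q. Peng, *Anomalous dissipation at Onsager-critical regularity*, arXiv:2512.24568 (2025), §1.
* A. Alexakis, C. R. Doering, Phys. Lett. A 359 (2006) 652–657, §§2–3 (vorticity-level bounds; time-dependent forcing).
-/

open MeasureTheory Set Filter Topology
open scoped ENNReal NNReal

noncomputable section

namespace Literature.Barriers.AnomalousDissipation

/-- The flat three-torus `T³ = (ℝ/ℤ)³` (local notation). -/
local notation "𝕋³" => UnitAddTorus (Fin 3)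
/-- Velocity values (local notation). -/
local notation "E³" => EuclideanSpace ℝ (Fin 3)

/-- **Technique class: force-robust no-anomaly statements around a limit force `f` of period `τ`.**
The conclusion of `Literature.Analysis.FluidPDE.ZerothLawNeg` ("the mean dissipation `ν_j⟨‖∇u_j‖₂²⟩`
tends to `0` along every vanishing-viscosity family with bounded mean energy") asserted for the
families of Cheskidov's class (arXiv:2311.04182, §1.2, the setting of Thms. 1.2–1.3) around the
given data: provided `τ > 0` and `f ∈ C(ℝ; L²(T³))` is `τ`-periodic — viscosities `ν_j > 0`,
`ν_j → 0`, smooth `τ`-periodic divergence-free mean-zero forces `f_j → f` uniformly in `L²`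
(`sup_t ‖f_j(t) - f(t)‖_{L²} → 0`), and smooth `τ`-periodic mean-zero solutions `(u_j, p_j)` of
Navier–Stokes with viscosity `ν_j` and force `f_j` on `ℝ × T³` with bounded mean energies. An
argument for `Literature.Analysis.FluidPDE.ZerothLawNeg` that does not use that the force is
*exactly* `ν`-independent (and steady) — i.e. one stable under such perturbations of the force, as
the Doering–Foias energy estimates are (op. cit., Thm. 1.2) — proves `ForceRobustNoAnomalyAt τ f`
for every `τ` and `f`; Thm. 1.3 exhibits `(τ, f)` for which it fails
(`Cheskidov2023_thm13_exists_not_forceRobustNoAnomalyAt`). A DEFINITION (the class of conclusions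
the barrier quantifies over), not a result. [cite: Cheskidov2023, §1.2, Thms. 1.2–1.3] -/
def ForceRobustNoAnomalyAt (τ : ℝ) (f : ℝ → 𝕋³ → E³) : Prop :=
  ∀ (ν : ℕ → ℝ) (fs us : ℕ → ℝ → 𝕋³ → E³) (ps : ℕ → ℝ → 𝕋³ → ℝ),
    0 < τ → Function.Periodic f τ → Literature.Analysis.FluidPDE.Torus.ContinuousInLpOn univ 2 f →
    (∀ j, 0 < ν j) → Tendsto ν atTop (𝓝 0) →
    (∀ j, Literature.Analysis.FunctionSpaces.Torus.IsSmoothSpaceTimeOn univ (fs j) ∧ Function.Periodic (fs j) τ ∧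
      ∀ t, Literature.Analysis.FunctionSpaces.Torus.IsDivFree (fs j t) ∧ Literature.Analysis.FunctionSpaces.Torus.HasZeroMean (fs j t)) →
    Tendsto (fun j => ⨆ t : ℝ, eLpNorm (fs j t - f t) 2 volume) atTop (𝓝 0) →
    (∀ j, Literature.Analysis.FunctionSpaces.Torus.IsClassicalNSSolutionOn univ (ν j) (fs j) (us j) (ps j) ∧
      Function.Periodic (us j) τ ∧ ∀ t, Literature.Analysis.FunctionSpaces.Torus.HasZeroMean (us j t)) →
    (∃ E : ℝ, ∀ j, Literature.Analysis.FluidPDE.meanEnergy (us j) ≤ E) →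
    Tendsto (fun j => Literature.Analysis.FluidPDE.meanDissipation (ν j) (us j)) atTop (𝓝 0)

/-- **The force-robust no-anomaly statement for ALL periods and limit forces** — the technique
class of this barrier written as one closed proposition, `∀ τ f, ForceRobustNoAnomalyAt τ f`
(arXiv:2311.04182, §1.2, setting of Thms. 1.2–1.3).

DEPRECATED (verdict clean-up 2026-08-15 — REFUTED, retired as a named fact): this closed
`def … : Prop` was read as literature debt, but it is the class of conclusions the barrier STOPS —
FALSE by design, no `ForceRobustNoAnomaly_holds` can exist: Cheskidov's Thm. 1.3 exhibits a family
in the class with mean dissipation bounded below. Refuted in the tree by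
`Literature.Barriers.AnomalousDissipation.not_forceRobustNoAnomaly` =
`Cheskidov2023_thm13_not_forceRobustNoAnomaly` (from the accepted named fact
`Literature.Analysis.FluidPDE.cheskidov_time_periodic_anomaly`; witness form
`Cheskidov2023_thm13_exists_not_forceRobustNoAnomalyAt`). The technique class lives on as the
predicate `ForceRobustNoAnomalyAt τ f`, to which this def unfolds (`∀ τ f, …`, definitionally the
statement vendored before the clean-up); every statement of this file uses the predicate. As a
hypothesis write `∀ τ f, ForceRobustNoAnomalyAt τ f`; do not use this name in new code.
[cite: Cheskidov2023, §1.2, Thms. 1.2–1.3] -/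
@[deprecated "REFUTED technique class, retired as a named fact (verdict clean-up 2026-08-15) — see Literature.Barriers.AnomalousDissipation.not_forceRobustNoAnomaly / Cheskidov2023_thm13_not_forceRobustNoAnomaly; the class is the predicate ForceRobustNoAnomalyAt, write `∀ τ f, ForceRobustNoAnomalyAt τ f`" (since := "2026-08-15")]
def ForceRobustNoAnomaly : Prop :=
  ∀ (τ : ℝ) (f : ℝ → 𝕋³ → E³), ForceRobustNoAnomalyAt τ f

/-- **Cheskidov's Theorem 1.3 exhibits a member of the technique class with an anomaly**
(A. Cheskidov, arXiv:2311.04182 (2023), Thm. 1.3, via the accepted named fact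
`Literature.Analysis.FluidPDE.cheskidov_time_periodic_anomaly`): for the period `τ` and the limit
force `f` of Thm. 1.3 — smooth time-periodic solutions, forces `f_j → f` in `C(ℝ; L²)`, bounded
mean energies, mean dissipation rates bounded below by some `ε > 0` — the statement
`ForceRobustNoAnomalyAt τ f` fails. [cite: Cheskidov2023, Thm. 1.3] -/
theorem Cheskidov2023_thm13_exists_not_forceRobustNoAnomalyAt
    (h : Literature.Analysis.FluidPDE.cheskidov_time_periodic_anomaly) :
    ∃ (τ : ℝ) (f : ℝ → 𝕋³ → E³), 0 < τ ∧ ¬ ForceRobustNoAnomalyAt τ f := by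
  obtain ⟨τ, f, ν, fs, us, ps, hτ, hper, hcont, hν, hν₀, hfs, hconv, hus, hE, ⟨ε, hε, hdiss⟩, _⟩ := h
  refine ⟨τ, f, hτ, fun hAt => ?_⟩
  have hlim := hAt ν fs us ps hτ hper hcont hν hν₀ hfs hconv hus hE
  have hlt : ∀ᶠ j in atTop, Literature.Analysis.FluidPDE.meanDissipation (ν j) (us j) < ε :=
    hlim.eventually (Iio_mem_nhds hε)
  obtain ⟨j, hj⟩ := hlt.exists
  exact (lt_irrefl ε) ((hdiss j).trans_lt hj)

/-- **Cheskidov's Theorem 1.3 refutes every force-robust no-anomaly statement** (A. Cheskidov,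
arXiv:2311.04182 (2023), Thm. 1.3, via the accepted named fact
`Literature.Analysis.FluidPDE.cheskidov_time_periodic_anomaly`): there is a family in the class
`ForceRobustNoAnomalyAt τ f` — smooth time-periodic solutions, forces `f_j → f` in `C(ℝ; L²)`, bounded
mean energies — whose mean dissipation rates are bounded below by some `ε > 0` ("dissipation
anomaly for long time averages, … proving that the Doering–Foias (2002) upper bound is sharp"),
so the mean dissipation does not tend to `0` along it: `¬ ∀ τ f, ForceRobustNoAnomalyAt τ f`
(definitionally `¬ ForceRobustNoAnomaly`, the deprecated closed def).

BARRIER (D-0021):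
- technique_class: energy-method velocity-level a-priori-estimates l2-dual-in-the-force doering-foias-bounds force-robust perturbation-stable-in-the-force long-time-averages neg-route upper-bound-methods
- blocks: proofs of the dual statement `Literature.Analysis.FluidPDE.ZerothLawNeg` (route `Neg`; equivalently refutations of `Literature.Turb.ZerothLaw` = `AnomalousDissipation`, cf. `Literature.Turb.zerothLawNeg_iff_not_zerothLaw`) and refutations of `Literature.Analysis.FluidPDE.ZerothLawTimePeriodic` by arguments whose conclusion (α) is stable under replacing the force by smooth `ν`-dependent time-periodic forces `f_j → f` converging in `C(ℝ; L²(T³))` ONLY and (β) does not use that the given force is steady, `ν`-independent, or smoother than `C(ℝ; C^α(T³))`, `α < 1`, in space uniformly in time — i.e. *velocity-level* estimates pairing the momentum equation with `L²`-continuous functionals of the force, the uniformity class in which the Doering–Foias bound `εℓ/U³ ≤ c₁ + c₂Re⁻¹` is asserted [cite: Cheskidov2023, §1.2 Thm. 1.2] — because in that class the bound is attained: `εℓ/U³ → c > 0` along smooth time-periodic solutions with `ν_j → 0` [cite: Cheskidov2023, Thm. 1.3]; such an argument would prove `ForceRobustNoAnomalyAt τ f` for all `τ, f`, refuted here. NOT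 blocked (audit 2026-08-15): vorticity-level estimates whose constants involve `‖∇f‖`, `‖Δf‖` (stable only under `C(ℝ; H¹)`-perturbations of the force) and arguments using the steadiness or smoothness of the given force — these prove at most `ForceRobustNoAnomalyNarrow`, which Thm. 1.3 does not refute (scope caveat (d)).
- because: the total-dissipation-anomaly construction of Thm. 2.1 (a planar field mixing the third velocity component to frequency `5^m` within one time unit, `2½`-dimensional, after Bruè–De Lellis) is extended to the whole time line periodically, giving ancient smooth time-periodic solutions `u^{ν_j} ∈ L^∞(ℝ; L²)` with forces `f^{ν_j} → f` in `C(ℝ; L²)` and `lim_j εℓ/U³ = c` [cite: Cheskidov2023, §1.2 Thm. 1.3 and abstract]; under long-time averaging the mean dissipation equals the mean work of the force for smooth solutions, and `lim_{ν→0} ε = lim_T T⁻¹∫₀ᵀ(u,f)` for the `C_w(ℝ;L²)` limit `u` [cite: Cheskidov2023, Remark 1.6]; uniformly-in-`L²`-small, `ν`-dependent changes of the force are invisible to energy-method bounds, whose constants "depend only on the limit shape function `φ`" [cite: Cheskidov2023, §1.2 and Thm. 1.2].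
- evasions_known: none published for a `ν`-independent force (re-checked 2026-08): with a fixed force "there is no known example of a sequence of the NSE solutions with `Re → ∞`, where [the Doering–Foias] bound … is attained" [cite: Cheskidov2023, §1.2]; on finite windows the `ν`-independence question is open [cite: BrueDeLellis2023, §2 Question 1] while the time-independence question [cite: BrueDeLellis2023, §2 Question 2] is answered with `ν`-DEPENDENT autonomous smooth forces `F^{ν_q} → F⁰` in `C^α` on `[0,1]` driving `2½`-dimensional solutions with an autonomous planar field [cite: JohanssonSorella2024, §1 Thm. 1.5] — neither a long-time statement nor a fixed force, hence no evasion here; the finite-time Onsager-critical `2½`-dimensional variant with an exponential time scale (cf. Remark 1.4 of the source) again uses `ν`-dependent forces [cite: CheskidovPeng2025, §1 p. 3]; in two space dimensions the fixed-force no-anomaly statement does hold, by VORTICITY-level estimates using `‖Δf‖` (`AlexakisDoering2006_energyDissipationBound`: `χ ≤ k_f² U F`, `k_f² = ‖Δf‖/‖f‖`, `ε ≤ (νU²χ)^{1/2}`; `Literature.Analysis.FluidPDE.constantin_ramos_2d` for Lipschitz forces with damping) [cite: AlexakisDoering2006PLA, §2] — an energy method outside the refuted class, its constants not being `C(ℝ;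 L²)`-continuous in the force.
- scope_caveats: (a) Thm. 1.3 has time-dependent (time-periodic) and `ν`-dependent forces and smooth time-periodic solutions; it says nothing against arguments that use the exact `ν`-independence or the steadiness of the force, the Leray–Hopf (possibly non-smooth, non-periodic) character of general solutions, or statistical/ensemble averaging — the source itself notes that the constructed solutions "might lose stability" at high `Re`, so that "there is no guarantee that the dissipation anomaly for the constructed sequence of solutions would be observable in numerical experiments run over long time" [cite: Cheskidov2023, §1.2, after Thm. 1.3]; (b) the limit force is only `f ∈ C(ℝ; L²(T³))` and the convergence `f^{ν_j} → f` is in `C(ℝ; L²)`, not in smoother norms; an almost Onsager-critical variant (`u^{ν_j}` bounded in `L³(0,T; C^α)`, `α < 1/3`) is announced as "out of scope of this note" [cite: Cheskidov2023, Remark 1.4]; (c) the technique class `ForceRobustNoAnomalyAt` is this file's formalisation of "stable under `C(ℝ;L²)`-perturbations of the force" in the exact clauses of the accepted `Literature.Analysis.FluidPDE.cheskidov_time_periodic_anomaly`; the source does not phrase Thm. 1.3 as a no-go theorem; (d) [audit 2026-08-15, NARROWING] the refuting family is `2½`-dimensional with limit force `f = (g, a h)`, `g = ∂ₜṽ + (ṽ·∇)ṽ`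 the Euler force of the glued Alberti–Crippa–Mazzucato drift [cite: Cheskidov2023, §3 p. 10 and Thm. 3.1]: time-dependent, in `C(ℝ; C^α(T²))` for every `α < 1` with `g^m → g` in `C([0,1]; C^α)` [cite: Cheskidov2023, §3 p. 10], but — by the block bounds `‖∂ₜᵏ v_n‖_{C^α} ≲ λ_n^{α-1}` (all `α ≥ 0`) and the compression of block `n` into `[t_n, t_{n+1})`, `t_n = 1 - (n+1)⁻²` — neither jointly smooth up to `t = 1` nor bounded in `C^{1+α}`, and with `ν`-dependent tails `g^m - g` (the drift force of the blocks `n > m`) of `C¹`/`H¹`-size of order `n⁶ · λ_n⁰`, without decay in `n`, so that no convergence in `C(ℝ; H¹)` is available (this file's reading of the printed bounds), while the third component `h^m = η'(t) θ̃^m` converges in `L^∞(ℝ; L²)` only [cite: Cheskidov2023, §6 p. 18]; so Thm. 1.3 refutes neither the restriction of the class to smooth (in particular steady smooth) limit forces nor its variant with `C(ℝ; H¹)`-convergent forces — formalised together as `ForceRobustNoAnomalyNarrow` (open) — and every `2½`-dimensional kinematic cascade of this kind stays on the rough side of the Bruè–De Lellis threshold: forces bounded in `C([0,1]; W^{1,p})`,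 `p < ∞`, give only enhanced dissipation `≥ C exp(-log^{2/3}(1/ν))` in that scheme, forces bounded in `C([0,1]; C^α)`, `α < 1`, give the anomaly [cite: BrueDeLellis2023, §1 Thms. 1.1–1.2]; (e) Thm. 1.2 of the source (uniformity of the Doering–Foias bound over shapes `φ^j → φ` in `C(ℝ; L²(T³))`, time-dependent `φ ∈ L^∞(ℝ; L²)`) is stated without proof ("following the argument of Doering and Foias … we can show") [cite: Cheskidov2023, §1.2 p. 4]; for time-dependent multipliers the Doering–Foias argument produces a term `⟨(u, ∂ₜAφ)⟩`, cf. the extra forcing time-scale `Ω_f⁻¹` of the two-dimensional time-dependent bounds [cite: AlexakisDoering2006PLA, §3]; the refutation below does not use Thm. 1.2; (f) the class fixes ONE period `τ` for all `j`, for forces and (smooth) solutions alike; families with `ν`-dependent periods, quasi-periodic or statistically stationary forcing, ensemble averages and Leray–Hopf solutions from initial data lie outside both the refuted statement and the refuting family.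
- status: established (Thm. 1.3 is a theorem; the refutation below is proved from the accepted named fact) [cite: Cheskidov2023, Thm. 1.3] -/
theorem Cheskidov2023_thm13_not_forceRobustNoAnomaly
    (h : Literature.Analysis.FluidPDE.cheskidov_time_periodic_anomaly) :
    ¬ ∀ (τ : ℝ) (f : ℝ → 𝕋³ → E³), ForceRobustNoAnomalyAt τ f := by
  intro hrobust
  obtain ⟨τ, f, _, hnot⟩ := Cheskidov2023_thm13_exists_not_forceRobustNoAnomalyAt h
  exact hnot (hrobust τ f)

/-- `not_<decl>` form of the refutation of the retired closed def `ForceRobustNoAnomaly`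
(`= ∀ τ f, ForceRobustNoAnomalyAt τ f`) by Thm. 1.3 as the accepted named fact. [cite: Cheskidov2023, Thm. 1.3] -/
theorem not_forceRobustNoAnomaly (h : Literature.Analysis.FluidPDE.cheskidov_time_periodic_anomaly) :
    ¬ ∀ (τ : ℝ) (f : ℝ → 𝕋³ → E³), ForceRobustNoAnomalyAt τ f :=
  Cheskidov2023_thm13_not_forceRobustNoAnomaly h

/-- The technique class at `(τ, f)` contains the fixed-force case it is meant to decide: for a
*fixed* smooth `τ`-periodic divergence-free mean-zero force `f` (take `f_j = f`) it yields the dual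
`ZerothLawNeg`-type conclusion for smooth `τ`-periodic families driven by `f`. [cite: Cheskidov2023, §1.2] -/
theorem ForceRobustNoAnomalyAt.fixedForce {τ : ℝ} {f : ℝ → 𝕋³ → E³}
    (hR : ForceRobustNoAnomalyAt τ f) (hτ : 0 < τ)
    (hf : Literature.Analysis.FunctionSpaces.Torus.IsSmoothSpaceTimeOn univ f) (hfper : Function.Periodic f τ)
    (hfcont : Literature.Analysis.FluidPDE.Torus.ContinuousInLpOn univ 2 f)
    (hfdiv : ∀ t, Literature.Analysis.FunctionSpaces.Torus.IsDivFree (f t))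
    (hfmean : ∀ t, Literature.Analysis.FunctionSpaces.Torus.HasZeroMean (f t))
    (ν : ℕ → ℝ) (hν : ∀ j, 0 < ν j) (hν₀ : Tendsto ν atTop (𝓝 0))
    (us : ℕ → ℝ → 𝕋³ → E³) (ps : ℕ → ℝ → 𝕋³ → ℝ)
    (hus : ∀ j, Literature.Analysis.FunctionSpaces.Torus.IsClassicalNSSolutionOn univ (ν j) f (us j) (ps j) ∧
      Function.Periodic (us j) τ ∧ ∀ t, Literature.Analysis.FunctionSpaces.Torus.HasZeroMean (us j t))
    (hE : ∃ E : ℝ, ∀ j, Literature.Analysis.FluidPDE.meanEnergy (us j) ≤ E) :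
    Tendsto (fun j => Literature.Analysis.FluidPDE.meanDissipation (ν j) (us j)) atTop (𝓝 0) := by
  refine hR ν (fun _ => f) us ps hτ hfper hfcont hν hν₀ (fun _ => ⟨hf, hfper, fun t =>
    ⟨hfdiv t, hfmean t⟩⟩) ?_ hus hE
  have h0 : (fun j : ℕ => ⨆ t : ℝ, eLpNorm ((fun _ => f) j t - f t) 2 volume) = fun _ => 0 := by
    funext j
    simp
  rw [h0]
  exact tendsto_const_nhds

/-- The force-robust statement for all `(τ, f)` in particular gives the dual `ZerothLawNeg`-type
conclusion for smooth time-periodic families driven by a *fixed* smooth time-periodic force (take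
`f_j = f`; name kept from the closed form, hypothesis now spelled `∀ τ f, ForceRobustNoAnomalyAt τ f`).
[cite: Cheskidov2023, §1.2] -/
theorem ForceRobustNoAnomaly.fixedForce (hR : ∀ (τ : ℝ) (f : ℝ → 𝕋³ → E³), ForceRobustNoAnomalyAt τ f)
    (τ : ℝ) (hτ : 0 < τ) (f : ℝ → 𝕋³ → E³)
    (hf : Literature.Analysis.FunctionSpaces.Torus.IsSmoothSpaceTimeOn univ f) (hfper : Function.Periodic f τ)
    (hfcont : Literature.Analysis.FluidPDE.Torus.ContinuousInLpOn univ 2 f)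
    (hfdiv : ∀ t, Literature.Analysis.FunctionSpaces.Torus.IsDivFree (f t)) (hfmean : ∀ t, Literature.Analysis.FunctionSpaces.Torus.HasZeroMean (f t))
    (ν : ℕ → ℝ) (hν : ∀ j, 0 < ν j) (hν₀ : Tendsto ν atTop (𝓝 0))
    (us : ℕ → ℝ → 𝕋³ → E³) (ps : ℕ → ℝ → 𝕋³ → ℝ)
    (hus : ∀ j, Literature.Analysis.FunctionSpaces.Torus.IsClassicalNSSolutionOn univ (ν j) f (us j) (ps j) ∧
      Function.Periodic (us j) τ ∧ ∀ t, Literature.Analysis.FunctionSpaces.Torus.HasZeroMean (us j t))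
    (hE : ∃ E : ℝ, ∀ j, Literature.Analysis.FluidPDE.meanEnergy (us j) ≤ E) :
    Tendsto (fun j => Literature.Analysis.FluidPDE.meanDissipation (ν j) (us j)) atTop (𝓝 0) :=
  (hR τ f).fixedForce hτ hf hfper hfcont hfdiv hfmean ν hν hν₀ us ps hus hE

/-! ### Audit 2026-08-15 (D-0021): the un-refuted residual of the technique class -/

/-- OPEN CONJECTURE — **residual technique class NOT refuted by Cheskidov's Theorem 1.3:
`H¹`-robust no-anomaly statements around a smooth force**, registered open statement
(CONVENTIONS §4; barrier-audit residual, D-0021, 2026-08-15; expected: undecided — a proof would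
refute `Literature.Analysis.FluidPDE.ZerothLawTimePeriodic` for smooth periodic solutions, a
refutation would be a long-time anomalous-dissipation family with `C(ℝ; H¹)`-convergent forcing
around a smooth force, beyond every published construction), not literature debt: no
`ForceRobustNoAnomalyNarrow_holds` is to be expected and users keep the explicit hypothesis
`(h : ForceRobustNoAnomalyNarrow)`. The conclusion of
`Literature.Analysis.FluidPDE.ZerothLawNeg` asserted for: a *smooth* `τ`-periodic force `f` on
`ℝ × T³`, divergence free and of zero mean at every time (the force class of
`Literature.Analysis.FluidPDE.ZerothLawTimePeriodic`; a steady smooth force is the case `f` constant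
in time; the clause `Torus.ContinuousInLpOn univ 2 f` of `ForceRobustNoAnomalyAt` is kept verbatim,
redundant as it is for smooth `f`), viscosities `ν_j > 0`, `ν_j → 0`, smooth `τ`-periodic
divergence-free mean-zero forces `f_j → f` in `C(ℝ; H¹(T³))` —
`sup_t (‖f_j(t) - f(t)‖_{L²} + ‖∇(f_j(t) - f(t))‖²_{L²}) → 0`, the gradient term being the
classical `Torus.gradNormSq` of the smooth difference — and smooth `τ`-periodic mean-zero
solutions `(u_j, p_j)` of Navier–Stokes with viscosity `ν_j` and force `f_j` on `ℝ × T³` with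
bounded mean energies. This is `∀ τ f, ForceRobustNoAnomalyAt τ f` (the retired closed def
`ForceRobustNoAnomaly`) with two clauses strengthened on the
hypothesis side — (K1) the limit force is smooth, (K2) the forces converge in `C(ℝ; H¹)` rather
than `C(ℝ; L²)` — hence a WEAKER statement (`ForceRobustNoAnomaly.narrow`) proved by a LARGER
class of arguments: the force-robust form of a vorticity-level a-priori estimate whose constants
depend on `‖∇f‖`, `‖Δf‖` (the mechanism of the two-dimensional no-anomaly proofs,
`χ = ⟨ω curl f⟩ ≤ k_f² U F` with `k_f² = ‖Δf‖/‖f‖` [cite: AlexakisDoering2006PLA, §2]), or of an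
argument exploiting the smoothness or steadiness of the given force, is this statement and not
`∀ τ f, ForceRobustNoAnomalyAt τ f`; and it still contains the fixed-force case the summit asks about
(`ForceRobustNoAnomalyNarrow.fixedForce`).

Why Thm. 1.3 does not refute it (either clause alone suffices). The refuting family
[cite: Cheskidov2023, Thm. 1.3 and §6 p. 18] is `2½`-dimensional with limit force `(g, a h)`,
`g = ∂ₜṽ + (ṽ·∇)ṽ` the Euler force of the glued mixing drift [cite: Cheskidov2023, §3 p. 10]:
time-dependent and only `C(ℝ; C^α)`, `α < 1`, in space (block bounds
`‖∂ₜᵏ v_n‖_{C^α} ≲ λ_n^{α-1}` for all `α ≥ 0` [cite: Cheskidov2023, Thm. 3.1], block `n`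
compressed into `[1-(n+1)⁻², 1-(n+2)⁻²)`), so (K1) fails; the convergence of the forces is
asserted in `C(ℝ; L²)` only — the `ν`-dependent drift-force tails have `C¹`/`H¹`-size of order
`n⁶ · λ_n⁰` by the printed block bounds, without decay in `n`, and the third force component
converges in `L^∞(ℝ; L²)` only [cite: Cheskidov2023, §6 p. 18] — so (K2) is not available. More
generally a `2½`-dimensional kinematic cascade with bounded resident scalar variance needs
summable scale-to-scale transfer times, which puts its limit drift force exactly at spatial
regularity `C^{1-}` / `H^{1-}` and its force tails outside `H¹` (this file's scaling remark),
matching the printed threshold: forces bounded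
in `C([0,1]; W^{1,p})`, `p < ∞`, give only enhanced dissipation in the Bruè–De Lellis scheme,
forces bounded in `C([0,1]; C^α)`, `α < 1`, give the anomaly
[cite: BrueDeLellis2023, §1 Thms. 1.1–1.2].

Residual standing: OPEN — neither proved (it contains the no-anomaly conclusion for smooth
periodic solutions driven by a fixed smooth periodic force, i.e. the smooth-periodic shadow of
`¬ Literature.Analysis.FluidPDE.ZerothLawTimePeriodic`) nor refuted (no published family with
`C(ℝ; H¹)`-convergent forces around a smooth force dissipates anomalously in the long-time mean;
`ν`-independent forces are open even on finite windows [cite: BrueDeLellis2023, §2 Question 1];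
with a fixed force the existence of a saturating sequence "remains an important open problem"
[cite: Cheskidov2023, §1.2, after Thm. 1.3]); its two-dimensional analogue holds by the
vorticity-level estimate `ε ≤ U^{4/3} (sup_t ‖curl f‖₂)^{2/3} ν^{1/3}` (enstrophy balance and
`‖ω‖₂² ≤ ‖u‖₂‖∇ω‖₂`, the Alexakis–Doering mechanism; this file's remark). This declaration records
the gap in the barrier above for planners (D-0021 idea-card seed); it is not itself a barrier.
Verdict clean-up 2026-08-15 (prove-seat verdict `open-problem`, re-verified): registered OPEN
statement confirmed, deliberately without `_holds`; name kept (no `…Conjecture` rename — users: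
`ForceRobustNoAnomaly.narrow`, `ForceRobustNoAnomalyNarrow.fixedForce`, and the `Barriers:` records
of the theses `BaireTransfer`, `FiniteIntersection`, `ResponseTelescope`).
[cite: Cheskidov2023, §1.2 Thm. 1.3 with §3 p. 10 and §6 p. 18 (what is refuted); BrueDeLellis2023, §2 Question 1 (posed as open)] [status: open] -/
@[conjecture] def ForceRobustNoAnomalyNarrow : Prop :=
  ∀ (τ : ℝ) (f : ℝ → 𝕋³ → E³) (ν : ℕ → ℝ) (fs us : ℕ → ℝ → 𝕋³ → E³) (ps : ℕ → ℝ → 𝕋³ → ℝ),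
    0 < τ → Literature.Analysis.FunctionSpaces.Torus.IsSmoothSpaceTimeOn univ f →
    Function.Periodic f τ → Literature.Analysis.FluidPDE.Torus.ContinuousInLpOn univ 2 f →
    (∀ t, Literature.Analysis.FunctionSpaces.Torus.IsDivFree (f t) ∧
      Literature.Analysis.FunctionSpaces.Torus.HasZeroMean (f t)) →
    (∀ j, 0 < ν j) → Tendsto ν atTop (𝓝 0) →
    (∀ j, Literature.Analysis.FunctionSpaces.Torus.IsSmoothSpaceTimeOn univ (fs j) ∧
      Function.Periodic (fs j) τ ∧
      ∀ t, Literature.Analysis.FunctionSpaces.Torus.IsDivFree (fs j t) ∧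
        Literature.Analysis.FunctionSpaces.Torus.HasZeroMean (fs j t)) →
    Tendsto (fun j => ⨆ t : ℝ, (eLpNorm (fs j t - f t) 2 volume +
      ENNReal.ofReal (Literature.Analysis.FunctionSpaces.Torus.gradNormSq (fs j t - f t))))
      atTop (𝓝 0) →
    (∀ j, Literature.Analysis.FunctionSpaces.Torus.IsClassicalNSSolutionOn univ (ν j) (fs j) (us j) (ps j) ∧
      Function.Periodic (us j) τ ∧
      ∀ t, Literature.Analysis.FunctionSpaces.Torus.HasZeroMean (us j t)) →
    (∃ E : ℝ, ∀ j, Literature.Analysis.FluidPDE.meanEnergy (us j) ≤ E) →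
    Tendsto (fun j => Literature.Analysis.FluidPDE.meanDissipation (ν j) (us j)) atTop (𝓝 0)

/-- The technique class at `(τ, f)` implies the residual statement at `(τ, f)`: the
`C(ℝ; H¹)`-distance dominates the `C(ℝ; L²)`-distance (`iSup_mono` and a squeeze in `ℝ≥0∞`),
and the extra smoothness hypotheses on the limit force are simply dropped; quantified over all
`(τ, f)` (name kept from the closed form): the refuted statement `∀ τ f, ForceRobustNoAnomalyAt τ f`
is the STRONGER one, and Thm. 1.3 is silent about the residual `ForceRobustNoAnomalyNarrow`.
[cite: Cheskidov2023, §1.2 Thms. 1.2–1.3] -/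
theorem ForceRobustNoAnomaly.narrow (hR : ∀ (τ : ℝ) (f : ℝ → 𝕋³ → E³), ForceRobustNoAnomalyAt τ f) :
    ForceRobustNoAnomalyNarrow := by
  intro τ f ν fs us ps hτ _hf hper hcont _hfdm hν hν₀ hfs hconv hus hE
  refine hR τ f ν fs us ps hτ hper hcont hν hν₀ hfs ?_ hus hE
  refine tendsto_of_tendsto_of_tendsto_of_le_of_le tendsto_const_nhds hconv (fun _ => zero_le) ?_
  intro j
  exact iSup_mono fun t => le_self_add

/-- The residual statement still contains the fixed-force case of the summit statements: for a
fixed smooth time-periodic divergence-free mean-zero force (take `f_j = f`, distance `0`) it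
yields the `Literature.Analysis.FluidPDE.ZerothLawNeg`-type conclusion for smooth `τ`-periodic
solutions — an argument in the un-refuted class would still decide the smooth-periodic shadow of
`Literature.Analysis.FluidPDE.ZerothLawTimePeriodic` (and, for `f` constant in time, of route
`Neg`). [cite: Cheskidov2023, §1.2] -/
theorem ForceRobustNoAnomalyNarrow.fixedForce (hR : ForceRobustNoAnomalyNarrow) (τ : ℝ)
    (hτ : 0 < τ) (f : ℝ → 𝕋³ → E³)
    (hf : Literature.Analysis.FunctionSpaces.Torus.IsSmoothSpaceTimeOn univ f)
    (hfper : Function.Periodic f τ)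
    (hfcont : Literature.Analysis.FluidPDE.Torus.ContinuousInLpOn univ 2 f)
    (hfdiv : ∀ t, Literature.Analysis.FunctionSpaces.Torus.IsDivFree (f t))
    (hfmean : ∀ t, Literature.Analysis.FunctionSpaces.Torus.HasZeroMean (f t))
    (ν : ℕ → ℝ) (hν : ∀ j, 0 < ν j) (hν₀ : Tendsto ν atTop (𝓝 0))
    (us : ℕ → ℝ → 𝕋³ → E³) (ps : ℕ → ℝ → 𝕋³ → ℝ)
    (hus : ∀ j, Literature.Analysis.FunctionSpaces.Torus.IsClassicalNSSolutionOn univ (ν j) f (us j) (ps j) ∧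
      Function.Periodic (us j) τ ∧
      ∀ t, Literature.Analysis.FunctionSpaces.Torus.HasZeroMean (us j t))
    (hE : ∃ E : ℝ, ∀ j, Literature.Analysis.FluidPDE.meanEnergy (us j) ≤ E) :
    Tendsto (fun j => Literature.Analysis.FluidPDE.meanDissipation (ν j) (us j)) atTop (𝓝 0) := by
  refine hR τ f ν (fun _ => f) us ps hτ hf hfper hfcont (fun t => ⟨hfdiv t, hfmean t⟩) hν hν₀
    (fun _ => ⟨hf, hfper, fun t => ⟨hfdiv t, hfmean t⟩⟩) ?_ hus hE
  have h0 : (fun j : ℕ => ⨆ t : ℝ, (eLpNorm ((fun _ => f) j t - f t) 2 volume +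
      ENNReal.ofReal
        (Literature.Analysis.FunctionSpaces.Torus.gradNormSq ((fun _ => f) j t - f t)))) =
      fun _ => 0 := by
    funext j
    have hsub : ∀ t : ℝ, (fun _ : ℕ => f) j t - f t = 0 := fun t => sub_self _
    simp only [hsub, eLpNorm_zero, zero_add]
    simp [Literature.Analysis.FunctionSpaces.Torus.gradNormSq,
      Literature.Analysis.FunctionSpaces.Torus.partialDeriv,
      Literature.Analysis.FunctionSpaces.Torus.lineDeriv]
  rw [h0]
  exact tendsto_const_nhds

end Literature.Barriers.AnomalousDissipation

end
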